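import Mathlib.LinearAlgebra.Matrix.NonsingularInverse
import Summits.Ventures.LatticeQCDFlow.Scoring.SchwingerDysonPhi4GibbsPolynomial
import HarnessLib

/-!
# The free lattice propagator from Schwinger–Dyson alone: `(J + Jᵀ) G = 1`, and the interacting propagator equation in the engine's convention

HONEST FRAMING: exact (Metropolis-corrected) sampling algorithms for lattice gauge theory;
figures of merit are autocorrelation/cost numbers at stated couplings and volumes; no
continuum-physics claim.  (SCALAR calibration rung S0-A: not a gauge result.)

Venture `LatticeQCDFlow` (cell pub-lqcd), sub-topic `Scoring`; FANOUT row 2 (`s0-phi4`).  NEW WORK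
of the cell.  Sixth file of the φ⁴ Schwinger–Dyson series; discharges the coercivity hypothesis of
`SchwingerDysonPhi4GibbsMonomial.lean` / `…Polynomial.lean` in the GAUSSIAN regime and types the
exactness battery's leg T1 ("exact free-field limit", BATTERY-REPORT.md v1.1) in position space.

* `latticePhi4Action_coercive_of_quadForm_ge` — if the quadratic part dominates `ε Σ φ²`
  (`ε > 0`, i.e. `J + Jᵀ ≽ 2ε`) and `λ ≥ 0`, the action is coercive (`K = 0`): every identity of
  the two companion files holds, INCLUDING `λ = 0`;
* `shiftCoupling_quadForm_ge` / `shiftCoupling_coercive_of_pos_mass` — the engine's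
  nearest-neighbour action (latflow.core `phi4_2d`, AKS 2019 eq. (3.35), `J = −Δ_lat + m²`) with
  `m² > 0`, `λ ≥ 0` is coercive with `ε = m²` (the kinetic term is a sum of squares);
* **`free_propagator_sd`** (`λ = 0`): `Σ_z (J_{xz} + J_{zx}) ⟨φ_z φ_y⟩ = δ_{xy}`, i.e.
  (`free_propagator_mul`, `free_propagator_eq_inv`) the matrix `G = (⟨φ_z φ_y⟩)_{z,y}` satisfies
  `(J + Jᵀ) G = 1` and `G = (J + Jᵀ)⁻¹` — the Gaussian two-point function obtained WITHOUT
  computing a Gaussian integral, from integration by parts and coercivity only;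
* **`free_propagator_shift`** — for the engine's free field (`m² > 0`, `λ = 0`) on a periodic
  lattice with shifts `σ_μ`: `Σ_μ (4G(x,y) − 2G(σ_μx, y) − 2G(σ_μ⁻¹x, y)) + 2m² G(x,y) = δ_{xy}`,
  the lattice Helmholtz equation `2(−Δ_lat + m²) G(·, y) = δ_y`, whose Fourier solution on
  `L₀ × L₁` is the battery's oracle `G̃(k) = 1/(2(m² + k̂²))`, `k̂² = Σ_μ 4 sin²(k_μ/2)`
  (the diagonalisation itself is not typed here);
* **`propagator_sd_shift`** — the INTERACTING version for the engine's action, `λ > 0`, any real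
  `m²` (incl. the tachyonic AKS 2019 sets `m² = −4`):
  `Σ_μ (4G(x,y) − 2G(σ_μx,y) − 2G(σ_μ⁻¹x,y)) + 2m² G(x,y) + 4λ ⟨φ_x³ φ_y⟩ = δ_{xy}` — a reference-free
  exactness relation between the measured two-point function and the measured `φ³–φ` insertion at
  every separation, for the joint Gibbs law.

NOT here: the momentum-space form / lattice Fourier analysis; Wick's theorem; statistical power.
-/

namespace Summit.Ventures.LatticeQCDFlow.Scoring

open Real MeasureTheory Set Filter Finset

section FreePropagator

variable {n : ℕ}

/-! ## Coercivity from the quadratic part -/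

/-- **Coercivity from a positive-definite symmetric part.**  If `ε Σ_w φ_w² ≤ Σ_{x,y} φ_x J_{xy} φ_y`
for all `φ` and `λ ≥ 0`, then `ε Σ φ² − 0 ≤ S(φ)`: the hypothesis of the companion files, now
including the Gaussian case `λ = 0`. -/
theorem latticePhi4Action_coercive_of_quadForm_ge {J : Fin (n + 1) → Fin (n + 1) → ℝ}
    {lam ε : ℝ} (hlam : 0 ≤ lam)
    (hJ : ∀ φ : Fin (n + 1) → ℝ, ε * ∑ w, φ w ^ 2 ≤ ∑ x, ∑ y, φ x * J x y * φ y)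
    (φ : Fin (n + 1) → ℝ) :
    ε * ∑ w, φ w ^ 2 - 0 ≤ latticePhi4Action J lam φ := by
  have h4 : 0 ≤ lam * ∑ x, φ x ^ 4 :=
    mul_nonneg hlam (Finset.sum_nonneg fun x _ => by positivity)
  have h := hJ φ
  unfold latticePhi4Action
  linarith

/-- **The engine's quadratic form dominates `m² Σ φ²`**: for `J = shiftCoupling σ m²`
(`−Δ_lat + m²` in Kronecker form), `Σ φJφ = Σ_x [Σ_μ (φ(σ_μ x) − φ_x)² + m² φ_x²] ≥ m² Σ_x φ_x²`. -/
theorem shiftCoupling_quadForm_ge {ι : Type*} [Fintype ι] (σ : ι → Equiv.Perm (Fin (n + 1)))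
    (m2 : ℝ) (φ : Fin (n + 1) → ℝ) :
    m2 * ∑ w, φ w ^ 2 ≤ ∑ x, ∑ y, φ x * shiftCoupling σ m2 x y * φ y := by
  have h := shiftPhi4Action_eq σ m2 0 φ
  unfold latticePhi4Action at h
  rw [zero_mul, add_zero] at h
  rw [← h]
  unfold shiftPhi4Action
  rw [Finset.mul_sum]
  refine Finset.sum_le_sum fun x _ => ?_
  have hk : 0 ≤ ∑ μ, (φ (σ μ x) - φ x) ^ 2 := Finset.sum_nonneg fun μ _ => sq_nonneg _
  linarith

/-- **The engine's action with `m² > 0`, `λ ≥ 0` is coercive** with `ε = m²`, `K = 0`. -/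
theorem shiftCoupling_coercive_of_pos_mass {ι : Type*} [Fintype ι]
    (σ : ι → Equiv.Perm (Fin (n + 1))) {m2 lam : ℝ} (hlam : 0 ≤ lam) (φ : Fin (n + 1) → ℝ) :
    m2 * ∑ w, φ w ^ 2 - 0 ≤ latticePhi4Action (shiftCoupling σ m2) lam φ :=
  latticePhi4Action_coercive_of_quadForm_ge hlam (shiftCoupling_quadForm_ge σ m2) φ

/-! ## The free propagator -/

/-- **The free propagator solves `(J + Jᵀ) G = 1`, entrywise** (`λ = 0`, `J + Jᵀ ≽ 2ε > 0`):
`Σ_z (J_{xz} + J_{zx}) ⟨φ_z φ_y⟩ = δ_{xy}` — the propagator equation `gibbs_propagator_sd` with the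
quartic insertion absent. -/
theorem free_propagator_sd {J : Fin (n + 1) → Fin (n + 1) → ℝ} {ε : ℝ} (hε : 0 < ε)
    (hJ : ∀ φ : Fin (n + 1) → ℝ, ε * ∑ w, φ w ^ 2 ≤ ∑ x, ∑ y, φ x * J x y * φ y)
    (x y : Fin (n + 1)) :
    ∑ z, (J x z + J z x) * gibbsExpect J 0 (fun φ => φ z * φ y) = if y = x then 1 else 0 := by
  have h := gibbs_propagator_sd_of_coercive hε
    (latticePhi4Action_coercive_of_quadForm_ge le_rfl hJ) x y
  simpa using h

/-- **Matrix form**: with `G_{zy} = ⟨φ_z φ_y⟩` (the two-point function of the Gaussian measure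
`e^{−φJφ} dφ / Z`), `(J + Jᵀ) G = 1`. -/
theorem free_propagator_mul {J : Fin (n + 1) → Fin (n + 1) → ℝ} {ε : ℝ} (hε : 0 < ε)
    (hJ : ∀ φ : Fin (n + 1) → ℝ, ε * ∑ w, φ w ^ 2 ≤ ∑ x, ∑ y, φ x * J x y * φ y) :
    ((Matrix.of fun x z => J x z) + (Matrix.of fun x z => J x z).transpose)
        * Matrix.of (fun z y => gibbsExpect J 0 (fun φ => φ z * φ y))
      = (1 : Matrix (Fin (n + 1)) (Fin (n + 1)) ℝ) := by
  ext x y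
  rw [Matrix.mul_apply, Matrix.one_apply]
  simp only [Matrix.add_apply, Matrix.transpose_apply, Matrix.of_apply]
  rw [free_propagator_sd hε hJ x y]
  by_cases h : x = y
  · rw [if_pos h, if_pos h.symm]
  · rw [if_neg h, if_neg (fun h' => h h'.symm)]

/-- **The free propagator is the inverse matrix**: `G = (J + Jᵀ)⁻¹` — for symmetric `J` this is
`(2J)⁻¹`; for the engine's `J = −Δ_lat + m²` (whose symmetrisation is `2(−Δ_lat + m²)`) it is the
battery's free-field oracle `G̃(k) = 1/(2(m² + k̂²))` in position space. -/
theorem free_propagator_eq_inv {J : Fin (n + 1) → Fin (n + 1) → ℝ} {ε : ℝ} (hε : 0 < ε)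
    (hJ : ∀ φ : Fin (n + 1) → ℝ, ε * ∑ w, φ w ^ 2 ≤ ∑ x, ∑ y, φ x * J x y * φ y) :
    Matrix.of (fun z y => gibbsExpect J 0 (fun φ => φ z * φ y))
      = (((Matrix.of fun x z => J x z) + (Matrix.of fun x z => J x z).transpose))⁻¹ :=
  (Matrix.inv_eq_right_inv (free_propagator_mul hε hJ)).symm

/-! ## The engine's convention: lattice Helmholtz equation, free and interacting -/

/-- **The propagator equation in the engine's force convention**, under coercivity: for
`J = shiftCoupling σ m²` and any real `λ`,
`Σ_μ (4G(x,y) − 2G(σ_μ x, y) − 2G(σ_μ⁻¹ x, y)) + 2m² G(x,y) + 4λ ⟨φ_x³ φ_y⟩ = δ_{xy}`. -/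
theorem propagator_sd_shift_of_coercive {ι : Type*} [Fintype ι]
    (σ : ι → Equiv.Perm (Fin (n + 1))) {m2 lam ε K : ℝ} (hε : 0 < ε)
    (hS : ∀ φ : Fin (n + 1) → ℝ,
      ε * ∑ w, φ w ^ 2 - K ≤ latticePhi4Action (shiftCoupling σ m2) lam φ)
    (x y : Fin (n + 1)) :
    (∑ μ, (4 * gibbsExpect (shiftCoupling σ m2) lam (fun φ => φ x * φ y)
        - 2 * gibbsExpect (shiftCoupling σ m2) lam (fun φ => φ (σ μ x) * φ y)
        - 2 * gibbsExpect (shiftCoupling σ m2) lam (fun φ => φ ((σ μ).symm x) * φ y)))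
      + 2 * m2 * gibbsExpect (shiftCoupling σ m2) lam (fun φ => φ x * φ y)
      + 4 * lam * gibbsExpect (shiftCoupling σ m2) lam (fun φ => φ x ^ 3 * φ y)
      = if y = x then 1 else 0 := by
  set J := shiftCoupling σ m2 with hJdef
  rw [← gibbs_sd_two_point_of_coercive hε hS x y]
  have hI := fun z a => integrable_pow_mul_pow_mul_gibbsWeight_of_coercive hε hS z y a 1
  have hI1 : ∀ z, Integrable (fun φ : Fin (n + 1) → ℝ => φ z * φ y * gibbsWeight J lam φ) := by
    intro z
    refine (hI z 1).congr (Eventually.of_forall fun φ => ?_)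
    simp only [pow_one]
  have e : (fun φ : Fin (n + 1) → ℝ => φ y * latticePhi4Force J lam φ x)
      = fun φ => (∑ μ, (4 * (φ x * φ y) - 2 * (φ (σ μ x) * φ y) - 2 * (φ ((σ μ).symm x) * φ y)))
          + 2 * m2 * (φ x * φ y) + 4 * lam * (φ x ^ 3 * φ y) := by
    funext φ
    rw [hJdef, latticePhi4Force_shift, mul_add, mul_add, Finset.mul_sum]
    congr 1
    · congr 1
      · exact Finset.sum_congr rfl fun μ _ => by ring
      · ring
    · ring
  -- integrability of the summands
  have hμ : ∀ μ : ι, Integrable (fun φ : Fin (n + 1) → ℝ =>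
      (4 * (φ x * φ y) - 2 * (φ (σ μ x) * φ y) - 2 * (φ ((σ μ).symm x) * φ y))
        * gibbsWeight J lam φ) := by
    intro μ
    refine ((((hI1 x).const_mul 4).sub ((hI1 (σ μ x)).const_mul 2)).sub
      ((hI1 ((σ μ).symm x)).const_mul 2)).congr (Eventually.of_forall fun φ => ?_)
    simp only [Pi.sub_apply]
    ring
  have hsum : Integrable (fun φ : Fin (n + 1) → ℝ =>
      (∑ μ, (4 * (φ x * φ y) - 2 * (φ (σ μ x) * φ y) - 2 * (φ ((σ μ).symm x) * φ y)))
        * gibbsWeight J lam φ) := by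
    refine (integrable_finsetSum Finset.univ fun μ (_ : μ ∈ Finset.univ) => hμ μ).congr
      (Eventually.of_forall fun φ => ?_)
    simp only [Finset.sum_mul]
  have hm : Integrable (fun φ : Fin (n + 1) → ℝ => 2 * m2 * (φ x * φ y) * gibbsWeight J lam φ) := by
    refine ((hI1 x).const_mul (2 * m2)).congr (Eventually.of_forall fun φ => ?_)
    dsimp only
    ring
  have hl : Integrable (fun φ : Fin (n + 1) → ℝ => 4 * lam * (φ x ^ 3 * φ y) * gibbsWeight J lam φ) := by
    refine ((hI x 3).const_mul (4 * lam)).congr (Eventually.of_forall fun φ => ?_)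
    simp only [pow_one]
    ring
  have hsm : Integrable (fun φ : Fin (n + 1) → ℝ =>
      ((∑ μ, (4 * (φ x * φ y) - 2 * (φ (σ μ x) * φ y) - 2 * (φ ((σ μ).symm x) * φ y)))
        + 2 * m2 * (φ x * φ y)) * gibbsWeight J lam φ) := by
    refine (hsum.add hm).congr (Eventually.of_forall fun φ => ?_)
    simp only [Pi.add_apply]
    ring
  rw [e, gibbsExpect_add J lam hsm hl, gibbsExpect_add J lam hsum hm,
    gibbsExpect_sum J lam Finset.univ (fun μ _ => hμ μ), gibbsExpect_const_mul,
    gibbsExpect_const_mul]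
  congr 2
  refine Finset.sum_congr rfl fun μ _ => ?_
  have ha : Integrable (fun φ : Fin (n + 1) → ℝ =>
      (4 * (φ x * φ y) - 2 * (φ (σ μ x) * φ y)) * gibbsWeight J lam φ) := by
    refine (((hI1 x).const_mul 4).sub ((hI1 (σ μ x)).const_mul 2)).congr
      (Eventually.of_forall fun φ => ?_)
    simp only [Pi.sub_apply]
    ring
  have hb : Integrable (fun φ : Fin (n + 1) → ℝ =>
      2 * (φ ((σ μ).symm x) * φ y) * gibbsWeight J lam φ) := by
    refine ((hI1 ((σ μ).symm x)).const_mul 2).congr (Eventually.of_forall fun φ => ?_)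
    dsimp only
    ring
  have hc : Integrable (fun φ : Fin (n + 1) → ℝ => 4 * (φ x * φ y) * gibbsWeight J lam φ) := by
    refine ((hI1 x).const_mul 4).congr (Eventually.of_forall fun φ => ?_)
    dsimp only
    ring
  have hd : Integrable (fun φ : Fin (n + 1) → ℝ => 2 * (φ (σ μ x) * φ y) * gibbsWeight J lam φ) := by
    refine ((hI1 (σ μ x)).const_mul 2).congr (Eventually.of_forall fun φ => ?_)
    dsimp only
    ring
  rw [gibbsExpect_sub J lam ha hb, gibbsExpect_sub J lam hc hd, gibbsExpect_const_mul,
    gibbsExpect_const_mul, gibbsExpect_const_mul]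

/-- **The interacting propagator equation for the engine's action**, `λ > 0`, ANY real `m²`
(incl. the tachyonic AKS 2019 sets): `Σ_μ (4G(x,y) − 2G(x+μ,y) − 2G(x−μ,y)) + 2m² G(x,y) +
4λ ⟨φ_x³ φ_y⟩ = δ_{xy}` — i.e. `2(−Δ_lat + m²) G(·,y) + 4λ ⟨φ³(·) φ_y⟩ = δ_y`, a reference-free
exactness relation between the measured two-point function and the measured `φ³–φ` insertion. -/
theorem propagator_sd_shift {ι : Type*} [Fintype ι] {lam : ℝ} (hlam : 0 < lam)
    (σ : ι → Equiv.Perm (Fin (n + 1))) (m2 : ℝ) (x y : Fin (n + 1)) :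
    (∑ μ, (4 * gibbsExpect (shiftCoupling σ m2) lam (fun φ => φ x * φ y)
        - 2 * gibbsExpect (shiftCoupling σ m2) lam (fun φ => φ (σ μ x) * φ y)
        - 2 * gibbsExpect (shiftCoupling σ m2) lam (fun φ => φ ((σ μ).symm x) * φ y)))
      + 2 * m2 * gibbsExpect (shiftCoupling σ m2) lam (fun φ => φ x * φ y)
      + 4 * lam * gibbsExpect (shiftCoupling σ m2) lam (fun φ => φ x ^ 3 * φ y)
      = if y = x then 1 else 0 :=
  propagator_sd_shift_of_coercive σ one_pos (latticePhi4Action_coercive hlam _) x y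

/-- **The free propagator of the engine's field solves the lattice Helmholtz equation**
(`m² > 0`, `λ = 0`; the exactness battery's leg T1 in position space):
`Σ_μ (4G(x,y) − 2G(x+μ,y) − 2G(x−μ,y)) + 2m² G(x,y) = δ_{xy}`, i.e. `2(−Δ_lat + m²) G(·,y) = δ_y`,
whose Fourier solution on the periodic lattice is `G̃(k) = 1/(2(m² + k̂²))`. -/
theorem free_propagator_shift {ι : Type*} [Fintype ι] (σ : ι → Equiv.Perm (Fin (n + 1)))
    {m2 : ℝ} (hm2 : 0 < m2) (x y : Fin (n + 1)) :
    (∑ μ, (4 * gibbsExpect (shiftCoupling σ m2) 0 (fun φ => φ x * φ y)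
        - 2 * gibbsExpect (shiftCoupling σ m2) 0 (fun φ => φ (σ μ x) * φ y)
        - 2 * gibbsExpect (shiftCoupling σ m2) 0 (fun φ => φ ((σ μ).symm x) * φ y)))
      + 2 * m2 * gibbsExpect (shiftCoupling σ m2) 0 (fun φ => φ x * φ y)
      = if y = x then 1 else 0 := by
  have h := propagator_sd_shift_of_coercive σ hm2
    (shiftCoupling_coercive_of_pos_mass σ (m2 := m2) le_rfl) x y
  simpa using h

/-- **All identities of the companion files hold for the engine's massive field at every
`λ ≥ 0`** — recorded for the score column: `m² > 0`, `λ ≥ 0`, shifts fixing no site ⇒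
`⟨F_x²⟩ = 2(2d + m²) + 12λ⟨φ_x²⟩` (at `λ = 0`: `⟨F_x²⟩ = 2(2d + m²)`, the Gaussian score). -/
theorem gibbs_score_shift_of_pos_mass {ι : Type*} [Fintype ι] (σ : ι → Equiv.Perm (Fin (n + 1)))
    {m2 lam : ℝ} (hm2 : 0 < m2) (hlam : 0 ≤ lam) (x : Fin (n + 1)) (hσ : ∀ μ, σ μ x ≠ x) :
    gibbsExpect (shiftCoupling σ m2) lam
        (fun φ => latticePhi4Force (shiftCoupling σ m2) lam φ x ^ 2)
      = 2 * (2 * Fintype.card ι + m2)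
        + 12 * lam * gibbsExpect (shiftCoupling σ m2) lam (fun φ => φ x ^ 2) := by
  rw [gibbs_score_of_coercive hm2 (shiftCoupling_coercive_of_pos_mass σ hlam),
    shiftCoupling_diag σ m2 x hσ]

end FreePropagator

end Summit.Ventures.LatticeQCDFlow.Scoring
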